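import Mathlib.Algebra.MvPolynomial.SchwartzZippel
import Mathlib.RingTheory.MvPolynomial.Homogeneous
import Mathlib.FieldTheory.Finite.Basic
import HarnessLib

/-!
# Cafure–Matera Lemma 2.2, proof part C: a good direction and the linear change of coordinates

Support file for the proof of `Literature.NumberTheory.DiophantineGeometry.CafureMatera2006_lemma22`
(`CafureMatera.lean`; assembled in `CafureMateraLemma22Proofs.lean`). Everything here is proved.

* Counting forms of Mathlib's Schwartz–Zippel lemma over `𝔽_q` (`card_eval_eq_zero_le`,
  `exists_eval_ne_zero`).
* `exists_coeff_line_ne_zero`: if `f ≠ 0` has total degree `d < q`, some `v ∈ 𝔽_q^N` has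
  `coeff_{t^d} f(tv) ≠ 0` (`= f_d(v)`, `f_d` the top homogeneous component, `coeff_aeval_line`).
* The `K`-algebra automorphism `X_0 ↦ v_0 X_0, X_{j+1} ↦ X_{j+1} + v_{j+1} X_0` (written inline as an
  `MvPolynomial.aeval`, no new definition): the corresponding linear map on points is injective when
  `v_0 ≠ 0` (`dirMap_injective`), and the substitution is bijective and preserves relative
  primality (`dirSubst_comp_inv`, explicit inverse; `isRelPrime_dirSubst`). Its effect on degrees,
  evaluation and the leading coefficient in `X_0` is in `CafureMateraLemma22Proofs.lean`.
-/

namespace Literature.NumberTheory.DiophantineGeometry.CafureMateraLemma22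

open MvPolynomial

open scoped Polynomial

variable {K : Type*} [Field K]

/-! ### Counting forms of the Schwartz–Zippel lemma over a finite field -/

section SZ

variable [Fintype K] [DecidableEq K]

/-- Schwartz–Zippel, counting form: a nonzero `p ∈ 𝔽_q[X_1, …, X_m]` has at most
`deg p · q^{m-1}` zeros in `𝔽_q^m` (from Mathlib's `MvPolynomial.schwartz_zippel_totalDegree`). [folklore] -/
theorem card_eval_eq_zero_le {m : ℕ} {p : MvPolynomial (Fin m) K} (hp : p ≠ 0) (hm : 1 ≤ m) :
    (Finset.univ.filter fun x : Fin m → K => eval x p = 0).card ≤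
      p.totalDegree * Fintype.card K ^ (m - 1) := by
  have hq : (0 : ℚ≥0) < Fintype.card K := by exact_mod_cast Fintype.card_pos
  have h := schwartz_zippel_totalDegree hp (Finset.univ : Finset K)
  rw [Finset.card_univ, div_le_div_iff₀ (pow_pos hq _) hq] at h
  have huniv : (Fintype.piFinset fun _ : Fin m => (Finset.univ : Finset K)) = Finset.univ :=
    Fintype.piFinset_univ
  rw [huniv] at h
  have h' : ((Finset.univ.filter fun x : Fin m → K => eval x p = 0).card : ℚ≥0) *
      Fintype.card K ≤ p.totalDegree * (Fintype.card K ^ (m - 1) * Fintype.card K) := by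
    calc _ ≤ (p.totalDegree : ℚ≥0) * Fintype.card K ^ m := h
      _ = _ := by rw [← pow_succ, Nat.sub_add_cancel hm]
  rw [← mul_assoc] at h'
  exact_mod_cast le_of_mul_le_mul_right h' hq

/-- Schwartz–Zippel, existence form: a nonzero polynomial of total degree `< q` does not vanish
on all of `𝔽_q^m`. [folklore] -/
theorem exists_eval_ne_zero {m : ℕ} {p : MvPolynomial (Fin m) K} (hp : p ≠ 0)
    (hdeg : p.totalDegree < Fintype.card K) : ∃ v : Fin m → K, eval v p ≠ 0 := by
  by_contra h
  push Not at h
  have hq : (0 : ℚ≥0) < Fintype.card K := by exact_mod_cast Fintype.card_pos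
  have hsz := schwartz_zippel_totalDegree hp (Finset.univ : Finset K)
  rw [Finset.card_univ, Fintype.piFinset_univ] at hsz
  have hall : (Finset.univ.filter fun x : Fin m → K => eval x p = 0) = Finset.univ :=
    Finset.filter_true_of_mem fun x _ => h x
  rw [hall, Finset.card_univ, Fintype.card_fun, Fintype.card_fin, Nat.cast_pow,
    div_self (pow_ne_zero _ hq.ne'), le_div_iff₀ hq, one_mul] at hsz
  exact absurd (by exact_mod_cast hsz) (not_le.2 hdeg)

end SZ

/-! ### The polynomial along a line through the origin -/

/-- The coefficient of `t^d` in `f(t v)` is the degree-`d` homogeneous component of `f` at `v`.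
[folklore] -/
theorem coeff_aeval_line {N : ℕ} (v : Fin N → K) (f : MvPolynomial (Fin N) K) (d : ℕ) :
    (aeval (fun i => Polynomial.C (v i) * Polynomial.X) f).coeff d =
      eval v (homogeneousComponent d f) := by
  classical
  induction f using MvPolynomial.induction_on' with
  | add p q hp hq => simp only [map_add, Polynomial.coeff_add, hp, hq]
  | monomial s c =>
    rw [aeval_monomial, Polynomial.algebraMap_apply, Algebra.algebraMap_self, RingHom.id_apply]
    have hprod : (s.prod fun i k => (Polynomial.C (v i) * Polynomial.X) ^ k) =
        Polynomial.C (s.prod fun i k => v i ^ k) * Polynomial.X ^ s.degree := by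
      rw [Finsupp.prod_pow, Finsupp.prod_pow, Finsupp.degree_eq_sum]
      simp only [mul_pow, ← Polynomial.C_pow, Finset.prod_mul_distrib, map_prod,
        Finset.prod_pow_eq_pow_sum]
    rw [hprod, Polynomial.coeff_C_mul, Polynomial.coeff_C_mul_X_pow]
    have hhc : homogeneousComponent d (monomial s c) =
        if s.degree = d then monomial s c else 0 := by
      ext m
      rw [coeff_homogeneousComponent, coeff_monomial]
      by_cases hsm : s = m
      · subst hsm
        by_cases h : s.degree = d
        · rw [if_pos h, if_pos h, coeff_monomial, if_pos rfl]
        · rw [if_neg h, if_neg h, coeff_zero]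
      · rw [if_neg hsm, ite_self]
        by_cases h : s.degree = d
        · rw [if_pos h, coeff_monomial, if_neg hsm]
        · rw [if_neg h, coeff_zero]
    rw [hhc]
    by_cases h : s.degree = d
    · rw [if_pos h, if_pos h.symm, eval_monomial]
    · rw [if_neg h, if_neg (Ne.symm h), map_zero, mul_zero]

/-- If `f(t v)` has a nonzero coefficient of `t^d` with `d ≥ 1`, then `v ≠ 0`. [folklore] -/
theorem exists_apply_ne_zero_of_coeff_line {N : ℕ} {v : Fin N → K} {f : MvPolynomial (Fin N) K}
    {d : ℕ} (hd : 1 ≤ d) (h : (aeval (fun i => Polynomial.C (v i) * Polynomial.X) f).coeff d ≠ 0) :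
    ∃ i₀, v i₀ ≠ 0 := by
  by_contra h0
  push Not at h0
  apply h
  have hv : (fun i => Polynomial.C (v i) * Polynomial.X) = fun _ => (0 : K[X]) := by
    funext i; simp [h0 i]
  rw [hv, aeval_zero', Polynomial.algebraMap_apply, Polynomial.coeff_C, if_neg (by omega)]

/-- **Good direction.** If `f ≠ 0` has total degree `d` with `1 ≤ d < q`, there is a direction
`v ∈ 𝔽_q^N` along which `f` keeps degree `d`: the coefficient of `t^d` in `f(t v)` is nonzero
(the top homogeneous part of `f` has a non-zero in `𝔽_q^N` by Schwartz–Zippel). [folklore] -/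
theorem exists_coeff_line_ne_zero [Fintype K] [DecidableEq K] {N : ℕ} {f : MvPolynomial (Fin N) K}
    (hf : f ≠ 0) (hdq : f.totalDegree < Fintype.card K) :
    ∃ v : Fin N → K,
      (aeval (fun i => Polynomial.C (v i) * Polynomial.X) f).coeff f.totalDegree ≠ 0 := by
  classical
  set d := f.totalDegree with hd
  set H := homogeneousComponent d f with hH
  have hH0 : H ≠ 0 := by
    obtain ⟨s, hs, hsd⟩ : ∃ s ∈ f.support, (s.sum fun _ e => e) = d := by
      have hne : f.support.Nonempty := support_nonempty.2 hf
      obtain ⟨s, hs, h⟩ := Finset.exists_mem_eq_sup _ hne (fun s : Fin N →₀ ℕ => s.sum fun _ e => e)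
      exact ⟨s, hs, h.symm⟩
    intro hz
    have := congrArg (coeff s) hz
    rw [hH, coeff_homogeneousComponent, coeff_zero, if_pos] at this
    · exact (mem_support_iff.1 hs) this
    · rw [Finsupp.degree_apply]; exact hsd
  have hHdeg : H.totalDegree < Fintype.card K :=
    lt_of_le_of_lt (homogeneousComponent_isHomogeneous d f).totalDegree_le hdq
  obtain ⟨v, hv⟩ := exists_eval_ne_zero hH0 hHdeg
  exact ⟨v, by rwa [coeff_aeval_line]⟩

/-! ### The linear change of coordinates making `X_0` point in the direction `v` -/

/-- The linear map on points is injective when `v 0 ≠ 0`. [folklore] -/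
theorem dirMap_injective {n : ℕ} (v : Fin (n + 1) → K) (hv : v 0 ≠ 0) :
    Function.Injective (fun x : Fin (n + 1) → K =>
      (Fin.cases (v 0 * x 0) (fun j => x j.succ + v j.succ * x 0) : Fin (n + 1) → K)) := by
  intro x y hxy
  have h0 : x 0 = y 0 := by
    have := congrFun hxy 0
    simp only [Fin.cases_zero] at this
    exact mul_left_cancel₀ hv this
  funext i
  refine Fin.cases h0 (fun j => ?_) i
  have := congrFun hxy j.succ
  simp only [Fin.cases_succ, h0] at this
  exact add_right_cancel this

/-- The substitution is an algebra automorphism: composing with the explicit inverse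
substitution `X_0 ↦ v_0⁻¹ X_0`, `X_{j+1} ↦ X_{j+1} - v_{j+1} v_0⁻¹ X_0` gives the identity, both
ways. [folklore] -/
theorem dirSubst_comp_inv {n : ℕ} (v : Fin (n + 1) → K) (hv : v 0 ≠ 0) :
    (aeval (Fin.cases (C (v 0) * X 0) (fun j => X j.succ + C (v j.succ) * X 0) :
      Fin (n + 1) → MvPolynomial (Fin (n + 1)) K)).comp
    (aeval (Fin.cases (C (v 0)⁻¹ * X 0) (fun j => X j.succ - C (v j.succ) * C (v 0)⁻¹ * X 0) :
      Fin (n + 1) → MvPolynomial (Fin (n + 1)) K)) = AlgHom.id K _ ∧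
    (aeval (Fin.cases (C (v 0)⁻¹ * X 0) (fun j => X j.succ - C (v j.succ) * C (v 0)⁻¹ * X 0) :
      Fin (n + 1) → MvPolynomial (Fin (n + 1)) K)).comp
    (aeval (Fin.cases (C (v 0) * X 0) (fun j => X j.succ + C (v j.succ) * X 0) :
      Fin (n + 1) → MvPolynomial (Fin (n + 1)) K)) = AlgHom.id K _ := by
  have hrel : (C (v 0) : MvPolynomial (Fin (n + 1)) K) * C (v 0)⁻¹ = 1 := by
    rw [← map_mul, mul_inv_cancel₀ hv, map_one]
  constructor
  · refine MvPolynomial.algHom_ext fun i => ?_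
    refine Fin.cases ?_ (fun j => ?_) i
    · simp only [AlgHom.coe_comp, Function.comp_apply, aeval_X, Fin.cases_zero, map_mul, aeval_C,
        algebraMap_eq, AlgHom.coe_id, id_eq]
      linear_combination (X 0 : MvPolynomial (Fin (n + 1)) K) * hrel
    · simp only [AlgHom.coe_comp, Function.comp_apply, aeval_X, Fin.cases_succ, map_sub, map_mul,
        aeval_C, algebraMap_eq, Fin.cases_zero, AlgHom.coe_id, id_eq]
      linear_combination (-(C (v j.succ) * X 0) : MvPolynomial (Fin (n + 1)) K) * hrel
  · refine MvPolynomial.algHom_ext fun i => ?_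
    refine Fin.cases ?_ (fun j => ?_) i
    · simp only [AlgHom.coe_comp, Function.comp_apply, aeval_X, Fin.cases_zero, map_mul, aeval_C,
        algebraMap_eq, AlgHom.coe_id, id_eq]
      linear_combination (X 0 : MvPolynomial (Fin (n + 1)) K) * hrel
    · simp only [AlgHom.coe_comp, Function.comp_apply, aeval_X, Fin.cases_succ, map_add, map_mul,
        aeval_C, algebraMap_eq, Fin.cases_zero, AlgHom.coe_id, id_eq]
      ring

/-- Relative primality is transported along multiplicative equivalences. [folklore] -/
theorem isRelPrime_map_mulEquiv {R S : Type*} [Monoid R] [Monoid S] (e : R ≃* S) {x y : R}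
    (h : IsRelPrime x y) : IsRelPrime (e x) (e y) := by
  intro d hx hy
  have hx' : e.symm d ∣ x := by simpa using map_dvd e.symm hx
  have hy' : e.symm d ∣ y := by simpa using map_dvd e.symm hy
  simpa using (h hx' hy').map e

/-- The substitution is bijective (when `v 0 ≠ 0`). [folklore] -/
theorem dirSubst_bijective {n : ℕ} (v : Fin (n + 1) → K) (hv : v 0 ≠ 0) :
    Function.Bijective (aeval (Fin.cases (C (v 0) * X 0) (fun j => X j.succ + C (v j.succ) * X 0) :
      Fin (n + 1) → MvPolynomial (Fin (n + 1)) K) :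
        MvPolynomial (Fin (n + 1)) K →ₐ[K] MvPolynomial (Fin (n + 1)) K) := by
  obtain ⟨h1, h2⟩ := dirSubst_comp_inv v hv
  let e : MvPolynomial (Fin (n + 1)) K ≃ₐ[K] MvPolynomial (Fin (n + 1)) K :=
    AlgEquiv.ofAlgHom _ _ h1 h2
  exact e.bijective

/-- The substitution preserves relative primality. [folklore] -/
theorem isRelPrime_dirSubst {n : ℕ} (v : Fin (n + 1) → K) (hv : v 0 ≠ 0)
    {f g : MvPolynomial (Fin (n + 1)) K} (h : IsRelPrime f g) :
    IsRelPrime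
      (aeval (Fin.cases (C (v 0) * X 0) (fun j => X j.succ + C (v j.succ) * X 0) :
        Fin (n + 1) → MvPolynomial (Fin (n + 1)) K) f)
      (aeval (Fin.cases (C (v 0) * X 0) (fun j => X j.succ + C (v j.succ) * X 0) :
        Fin (n + 1) → MvPolynomial (Fin (n + 1)) K) g) := by
  obtain ⟨h1, h2⟩ := dirSubst_comp_inv v hv
  let e : MvPolynomial (Fin (n + 1)) K ≃ₐ[K] MvPolynomial (Fin (n + 1)) K :=
    AlgEquiv.ofAlgHom _ _ h1 h2
  exact isRelPrime_map_mulEquiv e.toMulEquiv h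


end Literature.NumberTheory.DiophantineGeometry.CafureMateraLemma22
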